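import Mathlib
import Summits.NavierStokesRegularity.NavierStokesRegularity.Theorems.WakeRatchetTailTools
import Summits.NavierStokesRegularity.NavierStokesRegularity.Theses.WakeRatchet
import HarnessLib

/-!
# `WakeRatchet.TailEnvelopeFinite` (item stmt-NavierStokesRegularity-21809) — tail energies of a
  bounded admissible eternal solution are bounded in log-time

**Statement (the route decl, verbatim).** For `ε₀ > 0`, a CANCELLING table `α`
(`IsCancellingCoeff α`) and an admissible eternal solution `W` of the renormalised Tao-type MODEL
lattice with covariant viscosity (`IsEternalVisc ε₀ ν̂ α W`) obeying `UniformBound W`, every tail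
energy `Θ_n(σ) = Σ_{k ≥ 0} E_{n+k}(σ)` (`E = physEnergy`) is bounded uniformly in `σ ∈ ℝ`.

PROOF (the item card's route, M-sized real analysis).
* BACKWARD / ANY TIME (`WakeRatchetTail.tsum_le_geom`): `Θ_n(σ) ≤ Λ^{-2n} e^{2σ} C²/(1 − Λ^{-2})`,
  which is increasing in `σ`; this settles `σ ≤ σ₀`.
* FORWARD (`σ ≥ σ₀`, where `σ₀` is the later of the two forward-bound thresholds of
  `IsEternalVisc.bdd` at shells `n − 1` and `n`): the finite tail `T_K = Σ_{j<K} E_{n+j}` obeys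
  `T_K' = F_{n−1} − F_{n−1+K} − (dissipation ≥ 0)` (`hasDerivAt_tail`); the incoming flux is
  `|F_{n−1}(σ)| ≤ 2 C_A Λ⁻¹ ‖W_n‖ E_{n−1} ≤ A e^{−σ}` (`abs_physFlux_in_le`, from
  `e^{2σ}‖W_{n−1}‖² ≤ P₁`, `e^{2σ}‖W_n‖² ≤ P₂`), the outgoing boundary flux is
  `|F_{n−1+K}(σ)| ≤ B_K e^{2σ}` with `B_K = 2 C_A Λ⁻¹ C³ Λ^{-2(n−1+K)} → 0` (`abs_physFlux_top_le`);
  hence `σ ↦ T_K(σ) + A e^{−σ} − (B_K/2) e^{2σ}` is non-increasing on `[σ₀, ∞)`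
  (`forward_partial`, Mathlib `antitoneOn_of_hasDerivWithinAt_nonpos`), so
  `T_K(σ) ≤ Θ_n(σ₀) + A e^{−σ₀} + (B_K/2) e^{2σ}`; letting `K → ∞` at fixed `σ` gives
  `Θ_n(σ) ≤ G₀ + A e^{−σ₀}` with `G₀` the geometric bound at `σ₀` (`main`).

HONEST FRAMING: bookkeeping about bounded eternal solutions of Tao-type MODEL lattice ODEs
(Tao 2016 §4, renormalised variables of §6.4); nothing here is a statement about the
Navier–Stokes equations, and the route's rung leaf (`TaoLadderRungTwoBreak.Target`, TL-M2Break)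
is not the summit Statement.
-/

noncomputable section

set_option linter.dupNamespace false

namespace Summit.NavierStokesRegularity.NavierStokesRegularity.Theorems

namespace TailEnvelopeFinite

open Filter Topology Set
open Literature.Analysis.FluidPDE Literature.Analysis.FluidPDE.TaoCascade
open WakeRatchetTail

variable {m : ℕ} {ε₀ νh : ℝ} {α : Fin m → Fin m → Fin m → ℤ × ℤ × ℤ → ℝ} {W : ℤ → ℝ → Em m}

/-- `d/dx e^{-x} = -e^{-x}`. [folklore] -/
theorem hasDerivAt_exp_neg' (x : ℝ) :
    HasDerivAt (fun y : ℝ => Real.exp (-y)) (-Real.exp (-x)) x := by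
  have h := (hasDerivAt_neg' (x := x)).exp
  simpa only [mul_neg, mul_one] using h

/-- `d/dx e^{2x} = 2 e^{2x}`. [folklore] -/
theorem hasDerivAt_exp_two_mul' (x : ℝ) :
    HasDerivAt (fun y : ℝ => Real.exp (2 * y)) (2 * Real.exp (2 * x)) x := by
  have h := ((hasDerivAt_id x).const_mul (2 : ℝ)).exp
  simp only [id, mul_one] at h
  convert h using 1
  ring

/-- FORWARD INCOMING FLUX: past the forward-bound thresholds of shells `n − 1` and `n`
(`e^{2σ}‖W_{n−1}‖² ≤ P₁`, `e^{2σ}‖W_n‖² ≤ P₂` for `σ ≥ σ₀`), the flux into the tail decays: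
`|F_{n−1}(σ)| ≤ 2 C_A Λ⁻¹ √P₂ · Λ^{-2(n−1)} P₁ · e^{−σ}`.
[cite: Tao2016AveragedNS, §4 Lemma 4.1 (4.8)–(4.10) in the self-similar variables of §6.4; elementary] -/
theorem abs_physFlux_in_le (hε : 0 < ε₀) (hc : IsCancellingCoeff α) {n : ℤ} {σ₀ P₁ P₂ σ : ℝ}
    (hP₁ : ∀ σ, σ₀ ≤ σ → Real.exp (2 * σ) * ‖W (n - 1) σ‖ ^ 2 ≤ P₁)
    (hP₂ : ∀ σ, σ₀ ≤ σ → Real.exp (2 * σ) * ‖W n σ‖ ^ 2 ≤ P₂) (hσ : σ₀ ≤ σ) :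
    |physFlux ε₀ α W (n - 1) σ| ≤
      2 * fluxConst α * (bigLam ε₀)⁻¹ * Real.sqrt P₂ * ((bigLam ε₀ ^ (n - 1))⁻¹ ^ 2 * P₁)
        * Real.exp (-σ) := by
  have hb : 0 < bigLam ε₀ := bigLam_pos (by linarith)
  have h := abs_physFlux_le hε hc W (n - 1) σ
  rw [sub_add_cancel] at h
  have hK0 : 0 ≤ 2 * fluxConst α * (bigLam ε₀)⁻¹ :=
    mul_nonneg (mul_nonneg zero_le_two (fluxConst_nonneg α)) (inv_nonneg.2 hb.le)
  -- `‖W_n(σ)‖ ≤ √P₂ e^{-σ}`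
  have hWn : ‖W n σ‖ ≤ Real.sqrt P₂ * Real.exp (-σ) := by
    have h2 := hP₂ σ hσ
    have hexp : Real.exp (2 * σ) = Real.exp σ ^ 2 := by
      rw [sq, ← Real.exp_add]; ring_nf
    have h3 : (Real.exp σ * ‖W n σ‖) ^ 2 ≤ P₂ := by rw [mul_pow, ← hexp]; exact h2
    have h4 : Real.exp σ * ‖W n σ‖ ≤ Real.sqrt P₂ := by
      have := Real.sqrt_le_sqrt h3
      rwa [Real.sqrt_sq (by positivity)] at this
    rw [Real.exp_neg, ← div_eq_mul_inv, le_div_iff₀ (Real.exp_pos σ)]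
    linarith
  have hE : physEnergy ε₀ W (n - 1) σ ≤ (bigLam ε₀ ^ (n - 1))⁻¹ ^ 2 * P₁ := by
    unfold physEnergy
    exact mul_le_mul_of_nonneg_left (hP₁ σ hσ) (sq_nonneg _)
  calc |physFlux ε₀ α W (n - 1) σ|
      ≤ 2 * fluxConst α * (bigLam ε₀)⁻¹ * ‖W n σ‖ * physEnergy ε₀ W (n - 1) σ := h
    _ ≤ 2 * fluxConst α * (bigLam ε₀)⁻¹ * (Real.sqrt P₂ * Real.exp (-σ))
          * ((bigLam ε₀ ^ (n - 1))⁻¹ ^ 2 * P₁) :=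
        mul_le_mul (mul_le_mul_of_nonneg_left hWn hK0) hE (physEnergy_nonneg _ _ _ _)
          (mul_nonneg hK0 (by positivity))
    _ = 2 * fluxConst α * (bigLam ε₀)⁻¹ * Real.sqrt P₂ * ((bigLam ε₀ ^ (n - 1))⁻¹ ^ 2 * P₁)
          * Real.exp (-σ) := by ring

/-- OUTGOING BOUNDARY FLUX under a uniform amplitude bound `‖W_k(σ)‖ ≤ C`:
`|F_k(σ)| ≤ 2 C_A Λ⁻¹ C · Λ^{-2k} e^{2σ} C²` — small for large `k` at fixed `σ`.
[cite: Tao2016AveragedNS, §4 Lemma 4.1 (4.8)–(4.10) in the self-similar variables of §6.4; elementary] -/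
theorem abs_physFlux_top_le (hε : 0 < ε₀) (hc : IsCancellingCoeff α) {C : ℝ}
    (hC : ∀ (k : ℤ) (σ : ℝ), ‖W k σ‖ ≤ C) (k : ℤ) (σ : ℝ) :
    |physFlux ε₀ α W k σ| ≤
      2 * fluxConst α * (bigLam ε₀)⁻¹ * C * ((bigLam ε₀ ^ k)⁻¹ ^ 2 * (Real.exp (2 * σ) * C ^ 2)) := by
  have hb : 0 < bigLam ε₀ := bigLam_pos (by linarith)
  have hC0 : 0 ≤ C := (norm_nonneg _).trans (hC 0 0)
  have h := abs_physFlux_le hε hc W k σ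
  have hK0 : 0 ≤ 2 * fluxConst α * (bigLam ε₀)⁻¹ :=
    mul_nonneg (mul_nonneg zero_le_two (fluxConst_nonneg α)) (inv_nonneg.2 hb.le)
  have hE : physEnergy ε₀ W k σ ≤ (bigLam ε₀ ^ k)⁻¹ ^ 2 * (Real.exp (2 * σ) * C ^ 2) := by
    have h2 : ‖W k σ‖ ^ 2 ≤ C ^ 2 := pow_le_pow_left₀ (norm_nonneg _) (hC _ _) 2
    unfold physEnergy
    exact mul_le_mul_of_nonneg_left (mul_le_mul_of_nonneg_left h2 (Real.exp_pos _).le)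
      (sq_nonneg _)
  calc |physFlux ε₀ α W k σ|
      ≤ 2 * fluxConst α * (bigLam ε₀)⁻¹ * ‖W (k + 1) σ‖ * physEnergy ε₀ W k σ := h
    _ ≤ 2 * fluxConst α * (bigLam ε₀)⁻¹ * C * ((bigLam ε₀ ^ k)⁻¹ ^ 2 * (Real.exp (2 * σ) * C ^ 2)) :=
        mul_le_mul (mul_le_mul_of_nonneg_left (hC _ _) hK0) hE (physEnergy_nonneg _ _ _ _)
          (mul_nonneg hK0 hC0)

/-- FORWARD BARRIER for the finite tail `T_K(x) = Σ_{j<K} E_{n+j}(x)`: if the incoming flux obeys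
`|F_{n−1}(x)| ≤ A e^{−x}` for `x ≥ σ₀` and the outgoing boundary flux `|F_{n−1+K}(x)| ≤ B e^{2x}`,
then `x ↦ T_K(x) + A e^{−x} − (B/2) e^{2x}` is non-increasing on `[σ₀, ∞)` (its derivative is
`F_{n−1} − F_{n−1+K} − dissipation − A e^{−x} − B e^{2x} ≤ 0`), whence the displayed inequality.
[cite: Tao2016AveragedNS, §4 Lemma 4.1 (4.8)–(4.10) with the viscous equation before Thm. 4.2, §6.4; elementary] -/
theorem forward_partial (hε : 0 < ε₀) (hc : IsCancellingCoeff α) (hW : IsEternalVisc ε₀ νh α W)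
    {n : ℤ} {σ₀ A B : ℝ} (K : ℕ)
    (hA : ∀ x, σ₀ ≤ x → |physFlux ε₀ α W (n - 1) x| ≤ A * Real.exp (-x))
    (hB : ∀ x, |physFlux ε₀ α W (n - 1 + K) x| ≤ B * Real.exp (2 * x))
    {σ : ℝ} (hσ : σ₀ ≤ σ) :
    (∑ j ∈ Finset.range K, physEnergy ε₀ W (n + j) σ) + A * Real.exp (-σ)
        - B / 2 * Real.exp (2 * σ) ≤
      (∑ j ∈ Finset.range K, physEnergy ε₀ W (n + j) σ₀) + A * Real.exp (-σ₀)
        - B / 2 * Real.exp (2 * σ₀) := by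
  have hν : 0 ≤ νh := hW.nonneg
  -- the derivative of the barrier function
  have hderiv : ∀ x : ℝ, HasDerivAt
      (fun y => (∑ j ∈ Finset.range K, physEnergy ε₀ W (n + j) y) + A * Real.exp (-y)
        - B / 2 * Real.exp (2 * y))
      (physFlux ε₀ α W (n - 1) x - physFlux ε₀ α W (n - 1 + K) x
        - (∑ j ∈ Finset.range K, 2 * viscCoef ε₀ νh (n + j) x * physEnergy ε₀ W (n + j) x)
        + A * (-Real.exp (-x)) - B / 2 * (2 * Real.exp (2 * x))) x := by
    intro x
    have ht := hasDerivAt_tail hε hW hc (n - 1) K x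
    rw [sub_add_cancel] at ht
    exact (ht.add ((hasDerivAt_exp_neg' x).const_mul A)).sub
      ((hasDerivAt_exp_two_mul' x).const_mul (B / 2))
  -- it is nonpositive past `σ₀`
  have hnonpos : ∀ x, σ₀ ≤ x →
      physFlux ε₀ α W (n - 1) x - physFlux ε₀ α W (n - 1 + K) x
        - (∑ j ∈ Finset.range K, 2 * viscCoef ε₀ νh (n + j) x * physEnergy ε₀ W (n + j) x)
        + A * (-Real.exp (-x)) - B / 2 * (2 * Real.exp (2 * x)) ≤ 0 := by
    intro x hx
    have h1 : physFlux ε₀ α W (n - 1) x ≤ A * Real.exp (-x) :=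
      (le_abs_self _).trans (hA x hx)
    have h2 : -physFlux ε₀ α W (n - 1 + K) x ≤ B * Real.exp (2 * x) :=
      (neg_le_abs _).trans (hB x)
    have h3 : 0 ≤ ∑ j ∈ Finset.range K,
        2 * viscCoef ε₀ νh (n + j) x * physEnergy ε₀ W (n + j) x := by
      refine Finset.sum_nonneg fun j _ => mul_nonneg (mul_nonneg zero_le_two ?_)
        (physEnergy_nonneg _ _ _ _)
      unfold viscCoef
      positivity
    linarith
  have hanti : AntitoneOn
      (fun y => (∑ j ∈ Finset.range K, physEnergy ε₀ W (n + j) y) + A * Real.exp (-y)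
        - B / 2 * Real.exp (2 * y)) (Ici σ₀) := by
    refine antitoneOn_of_hasDerivWithinAt_nonpos (convex_Ici σ₀)
      (fun x _ => (hderiv x).continuousAt.continuousWithinAt)
      (fun x _ => (hderiv x).hasDerivWithinAt) ?_
    intro x hx
    rw [interior_Ici] at hx
    exact hnonpos x (le_of_lt hx)
  exact hanti (self_mem_Ici (a := σ₀)) (mem_Ici.2 hσ) hσ

/-- **The item's content.** For `ε₀ > 0`, a cancelling table and a uniformly bounded admissible
eternal solution with covariant viscosity, every tail energy `Σ_{k ≥ 0} E_{n+k}(σ)` is bounded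
uniformly in `σ`.
[cite: Tao2016AveragedNS, §4 Lemma 4.1 (4.8)–(4.10) with the viscous equation before Thm. 4.2, §6.4; elementary] -/
theorem main (hε : 0 < ε₀) (hc : IsCancellingCoeff α) (hW : IsEternalVisc ε₀ νh α W)
    (hU : UniformBound W) (n : ℤ) :
    ∃ M : ℝ, ∀ σ : ℝ, ∑' k : ℕ, physEnergy ε₀ W (n + k) σ ≤ M := by
  obtain ⟨C, hC⟩ := hU
  have hC0 : 0 ≤ C := (norm_nonneg _).trans (hC 0 0)
  have hb : 0 < bigLam ε₀ := bigLam_pos (by linarith)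
  obtain ⟨hq0, hq1⟩ := inv_bigLam_sq_lt_one hε
  have hgap : 0 < 1 - (bigLam ε₀)⁻¹ ^ 2 := by linarith
  -- forward thresholds of shells `n - 1` and `n`
  obtain ⟨σ₁, P₁, hP₁⟩ := hW.bdd (n - 1)
  obtain ⟨σ₂, P₂, hP₂⟩ := hW.bdd n
  set σ₀ : ℝ := max σ₁ σ₂ with hσ₀
  have hP₁' : ∀ σ, σ₀ ≤ σ → Real.exp (2 * σ) * ‖W (n - 1) σ‖ ^ 2 ≤ P₁ :=
    fun σ h => hP₁ σ ((le_max_left _ _).trans h)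
  have hP₂' : ∀ σ, σ₀ ≤ σ → Real.exp (2 * σ) * ‖W n σ‖ ^ 2 ≤ P₂ :=
    fun σ h => hP₂ σ ((le_max_right _ _).trans h)
  have hP₁0 : 0 ≤ P₁ := le_trans (by positivity) (hP₁ σ₁ le_rfl)
  -- the incoming-flux constant `A ≥ 0` and the outgoing-flux constants `B_K → 0`
  set A : ℝ := 2 * fluxConst α * (bigLam ε₀)⁻¹ * Real.sqrt P₂ *
    ((bigLam ε₀ ^ (n - 1))⁻¹ ^ 2 * P₁) with hAdef
  have hA0 : 0 ≤ A := by
    have := fluxConst_nonneg α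
    positivity
  have hA : ∀ x, σ₀ ≤ x → |physFlux ε₀ α W (n - 1) x| ≤ A * Real.exp (-x) :=
    fun x hx => abs_physFlux_in_le hε hc hP₁' hP₂' hx
  set Bf : ℕ → ℝ := fun K => 2 * fluxConst α * (bigLam ε₀)⁻¹ * C *
    ((bigLam ε₀ ^ (n - 1 + (K : ℤ)))⁻¹ ^ 2 * C ^ 2) with hBdef
  have hBf0 : ∀ K, 0 ≤ Bf K := by
    intro K
    have := fluxConst_nonneg α
    have : 0 < bigLam ε₀ ^ (n - 1 + (K : ℤ)) := zpow_pos hb _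
    positivity
  have hB : ∀ (K : ℕ) (x : ℝ), |physFlux ε₀ α W (n - 1 + K) x| ≤ Bf K * Real.exp (2 * x) := by
    intro K x
    calc |physFlux ε₀ α W (n - 1 + K) x|
        ≤ 2 * fluxConst α * (bigLam ε₀)⁻¹ * C *
            ((bigLam ε₀ ^ (n - 1 + (K : ℤ)))⁻¹ ^ 2 * (Real.exp (2 * x) * C ^ 2)) :=
          abs_physFlux_top_le hε hc hC _ x
      _ = Bf K * Real.exp (2 * x) := by rw [hBdef]; ring
  have hBlim : Tendsto Bf atTop (𝓝 0) := by
    have e : ∀ K : ℕ, Bf K = 2 * fluxConst α * (bigLam ε₀)⁻¹ * C *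
        ((bigLam ε₀ ^ (n - 1))⁻¹ ^ 2 * C ^ 2) * ((bigLam ε₀)⁻¹ ^ 2) ^ K := by
      intro K
      rw [hBdef]
      simp only
      rw [inv_bigLam_zpow_add_sq hε (n - 1) K]
      ring
    have h := (tendsto_pow_atTop_nhds_zero_of_lt_one hq0 hq1).const_mul
      (2 * fluxConst α * (bigLam ε₀)⁻¹ * C * ((bigLam ε₀ ^ (n - 1))⁻¹ ^ 2 * C ^ 2))
    rw [mul_zero] at h
    exact h.congr' (Eventually.of_forall fun K => (e K).symm)
  -- the geometric bound at `σ₀`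
  set G₀ : ℝ := (bigLam ε₀ ^ n)⁻¹ ^ 2 * (Real.exp (2 * σ₀) * C ^ 2) * (1 - (bigLam ε₀)⁻¹ ^ 2)⁻¹
    with hG₀
  have hgeomσ : ∀ σ, σ ≤ σ₀ → ∑' k : ℕ, physEnergy ε₀ W (n + k) σ ≤ G₀ := by
    intro σ hσ
    refine (tsum_le_geom hε hC n σ).trans ?_
    have h1 : Real.exp (2 * σ) * C ^ 2 ≤ Real.exp (2 * σ₀) * C ^ 2 :=
      mul_le_mul_of_nonneg_right (Real.exp_le_exp.2 (by linarith)) (sq_nonneg C)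
    have h2 : 0 ≤ (bigLam ε₀ ^ n)⁻¹ ^ 2 := sq_nonneg _
    have h3 : 0 ≤ (1 - (bigLam ε₀)⁻¹ ^ 2)⁻¹ := inv_nonneg.2 hgap.le
    exact mul_le_mul_of_nonneg_right (mul_le_mul_of_nonneg_left h1 h2) h3
  refine ⟨G₀ + A * Real.exp (-σ₀), fun σ => ?_⟩
  rcases le_or_gt σ σ₀ with hσ | hσ
  · -- backward of the threshold: the geometric bound, monotone in `σ`
    have h1 := hgeomσ σ hσ
    have h2 : 0 ≤ A * Real.exp (-σ₀) := by positivity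
    linarith
  · -- forward of the threshold: barrier on the finite tails, then `K → ∞`
    have hsum := summable_tail hε ⟨C, hC⟩ n σ
    have hlhs : Tendsto (fun K : ℕ => ∑ j ∈ Finset.range K, physEnergy ε₀ W (n + j) σ) atTop
        (𝓝 (∑' k : ℕ, physEnergy ε₀ W (n + k) σ)) := hsum.hasSum.tendsto_sum_nat
    have hbound : ∀ K : ℕ, ∑ j ∈ Finset.range K, physEnergy ε₀ W (n + j) σ ≤
        G₀ + A * Real.exp (-σ₀) + Bf K / 2 * Real.exp (2 * σ) := by
      intro K
      have h1 := forward_partial hε hc hW K hA (hB K) hσ.le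
      have h2 : ∑ j ∈ Finset.range K, physEnergy ε₀ W (n + j) σ₀ ≤ G₀ :=
        ((summable_tail hε ⟨C, hC⟩ n σ₀).sum_le_tsum (Finset.range K)
          (fun j _ => physEnergy_nonneg _ _ _ _)).trans (hgeomσ σ₀ le_rfl)
      have h3 : 0 ≤ A * Real.exp (-σ) := by positivity
      have h4 : 0 ≤ Bf K / 2 * Real.exp (2 * σ₀) := by
        have := hBf0 K
        positivity
      linarith
    have hrhs : Tendsto (fun K : ℕ => G₀ + A * Real.exp (-σ₀) + Bf K / 2 * Real.exp (2 * σ))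
        atTop (𝓝 (G₀ + A * Real.exp (-σ₀) + 0 / 2 * Real.exp (2 * σ))) :=
      tendsto_const_nhds.add ((hBlim.div_const 2).mul_const _)
    have := le_of_tendsto_of_tendsto' hlhs hrhs hbound
    simpa only [zero_div, zero_mul, add_zero] using this

end TailEnvelopeFinite

open TailEnvelopeFinite in
/-- **Item stmt-NavierStokesRegularity-21809** (`WakeRatchet.TailEnvelopeFinite`): for `ε₀ > 0`, a
cancelling table and a uniformly bounded admissible eternal solution with covariant viscosity of a
Tao-type MODEL lattice, every tail energy `Σ_{k ≥ 0} E_{n+k}(σ)` is bounded uniformly in `σ`.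
[cite: Tao2016AveragedNS, §4 Lemma 4.1 (4.8)–(4.10) with the viscous equation before Thm. 4.2, §6.4; elementary] -/
theorem wakeRatchet_tailEnvelopeFinite_proof :
    Summit.NavierStokesRegularity.NavierStokesRegularity.Theses.WakeRatchet.TailEnvelopeFinite := by
  unfold Summit.NavierStokesRegularity.NavierStokesRegularity.Theses.WakeRatchet.TailEnvelopeFinite
  intro ε₀ νh α W hε hc hW hU n
  exact main hε hc hW hU n

end Summit.NavierStokesRegularity.NavierStokesRegularity.Theorems

end
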